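import Summits.FinalStateConjecture.FinalStateConjecture.Theorems.PhaseMixingCaptureCaptureSufficesTameNoC0LimitLowest
import Summits.FinalStateConjecture.FinalStateConjecture.Theorems.PhaseMixingCaptureCaptureSufficesTameNoC0TubeAnalysis
import HarnessLib

/-!
# NoC0KerrChart limit argument IV: crossing points converge to the orbit

Crux `CaptureSufficesTame` (stmt-FinalStateConjecture-17270), line `only-the-third-law-is-generic`, NoC0KerrChart
programme, lead c10. Registered sub-goal of this file: `stub_noC0_crossingPoints` (`NoC0.crossing_points`): along the
ultrafilter the lowest points `x_n = Γ s + u_n ∂_{t*}` of `C_n` converge to `Γ s` — `lim u_n ≤ 0` by transplanting the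
drifted orbit (INC, TL), `lim u_n ≥ 0` because otherwise the reaching curves of `x_n` (hreach), lifted to causal curves of
the exterior, put `Γ s + u ∂_{t*}` in `J⁺(p₀)` (local closedness of `≤`), the static vertical curve pushes up to
`Γ s ∈ I⁺(p₀)`, excluded by O'Neill 14.2 (2) at `p₀` (`stub_noC0_kerrNullNotChronological`, supplied as hypothesis).

References: B. O'Neill, *Semi-Riemannian geometry* (1983), Ch. 14, Lemma 14.2, Cor. 14.1 (key `ONeillSemiRiemannian1983`).
-/


set_option linter.dupNamespace false
set_option maxSynthPendingDepth 3

noncomputable section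

open Set Filter Function Bundle MeasureTheory Metric
open scoped Manifold ContDiff Topology ENNReal

namespace Summit.FinalStateConjecture.FinalStateConjecture.Theorems.PhaseMixingCaptureCaptureSufficesTame

open Literature.Geometry.Lorentzian Literature.Geometry.Riemannian

namespace NoC0

variable {M a : ℝ}

set_option maxHeartbeats 400000 in
/-- **Crossing points.** On the vertical (`∂_{t*}`) segment through a small orbit point `Γ s` the lowest point `x_n` of `C_n`
is in `C_n ∖ O_n`, and `x_n → Γ s` along the ultrafilter: the top point `Γ s + s ∂_{t*}` is in `O_n` (incidence curve, (INC)),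
the limit offset `u` is `≤ 0` (else the drifted orbit, transplanted by (TL), ends in `O_n`) and `≥ 0` (else the reaching
curves of `x_n`, lifted to causal curves of the exterior, give `Γ s + u ∂_{t*} ∈ J⁺(p₀)` by local closedness of `≤`, the
vertical static curve pushes up to `Γ s ∈ I⁺(p₀)`, excluded by O'Neill 14.2 (2) at `p₀`). [cite: ONeillSemiRiemannian1983, Ch. 14, Lemma 14.2] -/
theorem crossing_points (M a : ℝ) [Kerr.Facts] [Kerr.SliceFacts] (hM : 0 < M) (ha0 : 0 ≤ a) (haM : a ≤ M)
    (r₀ q e S : ℝ) (h3 : 3 * M ≤ r₀) (hcubic : r₀ * (r₀ - 3 * M) ^ 2 = 4 * a ^ 2 * M)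
    (hq : q = √(M / r₀ ^ 3)) (he : e = 1 - a * q) (hS : S = 2 * Real.pi / q) (he0 : 0 < e) (hq0' : 0 < q)
    (p₀ : E4) (hp₀ : p₀ = Kerr.orbitCurve a r₀ q 0)
    (Ω : Set E4) (hΩext : closure Ω ⊆ (Kerr.exterior M a : Set E4))
    (η₀ : ℝ) (hη₀ : 0 < η₀)
    (htube : cthickening η₀ (Kerr.orbitCurve a r₀ q '' Icc (-S) (2 * S)) ⊆ Ω)
    (hH : ∀ y ∈ cthickening η₀ (Kerr.orbitCurve a r₀ q '' Icc (-S) (2 * S)), Kerr.scalarH M a y ≤ 2 / 5)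
    (𝒰 : Ultrafilter ℕ) (h𝒰 : (𝒰 : Filter ℕ) ≤ atTop)
    (ε : ℕ → ℝ) (hε0 : ∀ n, 0 ≤ ε n) (hε4 : ∀ n, ε n ≤ 1 / 80) (hεU : Tendsto ε (𝒰 : Filter ℕ) (𝓝 0))
    (B : ℕ → E4 → E4 →L[ℝ] E4 →L[ℝ] ℝ) (hB : ∀ n, ∀ y ∈ Ω, ‖B n y - Kerr.bilin M a y‖ ≤ ε n)
    (C O : ℕ → Set E4) (hOC : ∀ n, O n ⊆ C n) (hOo : ∀ n, IsOpen (O n))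
    (hCcl : ∀ n, ∀ y ∈ Ω, y ∈ closure (C n) → y ∈ C n)
    (hD : ∀ n, ∀ y ∈ C n, ∀ z ∈ Ω, (∃ (c : ℝ → E4) (s₁ s₂ : ℝ), s₁ < s₂ ∧ c s₁ = y ∧ c s₂ = z ∧
      ∀ t ∈ Icc s₁ s₂, c t ∈ Ω ∧ ∃ v : E4, HasDerivAt c v t ∧ B n (c t) v v < 0 ∧ 0 < v 0) → z ∈ O n)
    (hp : ∀ n, p₀ ∈ C n ∧ p₀ ∉ O n)
    (ht : ∀ n, ∀ y ∈ C n, p₀ 0 ≤ y 0)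
    (hreach : ∀ n, ∀ y ∈ C n, ∀ δ > 0, ∃ y' ∈ Ω, ‖y' - y‖ < δ ∧ (y' = p₀ ∨ ∃ c : ℝ → E4, c (p₀ 0) = p₀ ∧
      c (y' 0) = y' ∧ p₀ 0 < y' 0 ∧ ∀ t ∈ Icc (p₀ 0) (y' 0), c t ∈ Ω ∧ c t 0 = t ∧
        ∃ v : E4, HasDerivAt c v t ∧ B n (c t) v v ≤ 0 ∧ v 0 = 1))
    (W₂ : Set (Kerr.exterior M a))
    (hcl : ∀ (l : Filter ℕ) [l.NeBot] (x z : ℕ → Kerr.exterior M a) (x₀ z₀ : Kerr.exterior M a),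
      x₀ ∈ W₂ → z₀ ∈ W₂ → Tendsto x l (𝓝 x₀) → Tendsto z l (𝓝 z₀) →
      (∀ᶠ k in l, ∃ (γ : ℝ → Kerr.exterior M a) (a' b' : ℝ), a' ≤ b' ∧
        (Kerr.smoothMetric M a (Kerr.rPlus M a)).IsFutureCausalCurveOn
          (Kerr.exteriorSpacetime M a hM.le).timeOrientation γ (Icc a' b') ∧
        MapsTo γ (Icc a' b') W₂ ∧ γ a' = x k ∧ γ b' = z k) →
      z₀ ∈ (Kerr.smoothMetric M a (Kerr.rPlus M a)).causalFuture (Kerr.exteriorSpacetime M a hM.le).timeOrientation {x₀})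
    (ρ₂ : ℝ) (hρ₂ : 0 < ρ₂) (hρW : ∀ y : Kerr.exterior M a, ‖(y : E4) - p₀‖ < ρ₂ → y ∈ W₂)
    (s : ℝ) (hs : 0 < s) (hsη : 10 * s ≤ η₀) (hsρ : 40 * s ≤ ρ₂) (hsS : 2 * s ≤ e * S)
    (hLCxs : ∀ (h₁ : Kerr.orbitCurve a r₀ q (s / e) ∈ Kerr.exterior M a) (h₂ : p₀ ∈ Kerr.exterior M a),
      (⟨Kerr.orbitCurve a r₀ q (s / e), h₁⟩ : Kerr.region a (Kerr.rPlus M a)) ∉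
        (Kerr.smoothMetric M a (Kerr.rPlus M a)).chronologicalFuture (Kerr.exteriorSpacetime M a hM.le).timeOrientation
          {(⟨p₀, h₂⟩ : Kerr.region a (Kerr.rPlus M a))}) :
    ∃ x : ℕ → E4, (∀ᶠ n in (𝒰 : Filter ℕ), x n ∈ C n ∧ x n ∉ O n ∧
        ∃ u ∈ Icc (-s) s, x n = Kerr.orbitCurve a r₀ q (s / e) + u • E4.basisVector 0) ∧
      Tendsto x (𝒰 : Filter ℕ) (𝓝 (Kerr.orbitCurve a r₀ q (s / e))) := by
  subst hq
  subst hp₀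
  obtain ⟨-, -, hDL3, hTL, -, hINC⟩ := stub_noC0_tubeAnalysis
  haveI : Fact ((1 : ℕ∞ω) ≤ (∞ : ℕ∞ω)) := ⟨by exact_mod_cast le_top⟩
  haveI := LorentzianMetric.contMDiffCovariantDerivative_leviCivita_one (Kerr.smoothMetric M a (Kerr.rPlus M a))
  set τK := (Kerr.exteriorSpacetime M a hM.le).timeOrientation with hτK
  have hΩext' : Ω ⊆ (Kerr.exterior M a : Set E4) := subset_closure.trans hΩext
  /- ── orbit data ── -/
  have hr₀ : 0 < r₀ := by linarith
  have hrp : Kerr.rPlus M a < r₀ := (Kerr.rPlus_le_two_mul hM.le).trans_lt (by linarith)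
  have hmem : ∀ s, Kerr.orbitCurve a r₀ √(M / r₀ ^ 3) s ∈ Kerr.exterior M a := fun s ↦ by
    rw [Kerr.mem_exterior, Kerr.radius_orbitCurve hr₀]; exact max_lt hrp hr₀
  have htime : ∀ s, Kerr.orbitCurve a r₀ √(M / r₀ ^ 3) s 0 = e * s := fun s ↦ by
    rw [Kerr.orbitCurve_apply_zero, he]
  have hp00 : Kerr.orbitCurve a r₀ √(M / r₀ ^ 3) 0 0 = 0 := by rw [htime, mul_zero]
  have hq2 : √(M / r₀ ^ 3) ^ 2 * r₀ ^ 3 = M := by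
    rw [Real.sq_sqrt (by positivity)]; field_simp
  have hS0 : 0 < S := by rw [hS]; positivity
  have he0x : ∀ t, Kerr.orbitCurve a r₀ √(M / r₀ ^ 3) (t / e) 0 = t := fun t ↦ by rw [htime]; field_simp
  have horbkin := orbit_norm_sub_le M a r₀ e hM ha0 h3 hcubic he he0
  -- points near small orbit points are in the tube
  have hnear : ∀ t z, 0 ≤ t → t ≤ 2 * (e * S) → ‖z - Kerr.orbitCurve a r₀ √(M / r₀ ^ 3) (t / e)‖ ≤ η₀ →
      z ∈ cthickening η₀ (Kerr.orbitCurve a r₀ √(M / r₀ ^ 3) '' Icc (-S) (2 * S)) :=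
    fun t z ht0 htS hz ↦ mem_orbitTube he0 hS0.le t z ht0 htS hz
  have hΩnear : ∀ t z, 0 ≤ t → t ≤ 2 * (e * S) → ‖z - Kerr.orbitCurve a r₀ √(M / r₀ ^ 3) (t / e)‖ ≤ η₀ → z ∈ Ω :=
    fun t z ht0 htS hz ↦ htube (hnear t z ht0 htS hz)
  have hthickΓ := cthickening_subset_of_near_orbit he0 hS0.le hη₀ htube (q := √(M / r₀ ^ 3))
  -- the orbit point and the vertical segment through it
  set x₀ : E4 := Kerr.orbitCurve a r₀ √(M / r₀ ^ 3) (s / e) with hx₀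
  have hx₀0 : x₀ 0 = s := he0x s
  have hsmall : s ≤ 2 * (e * S) := by linarith
  have hne0 : ‖E4.basisVector 0‖ = 1 := by simp [E4.basisVector]
  /- ── Steps 3–4: the lowest point of `C n` on the vertical segment (`lowest_point`) ── -/
  have hgood : ∀ᶠ n in (𝒰 : Filter ℕ), ε n < 1 / 200 := hεU.eventually (gt_mem_nhds (by norm_num))
  have hcross : ∀ n, ε n < 1 / 200 → ∃ u ∈ Icc (-s) s, x₀ + u • E4.basisVector 0 ∈ C n ∧
      x₀ + u • E4.basisVector 0 ∉ O n := fun n hn ↦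
    lowest_point M a r₀ e S hM ha0 haM h3 hcubic he he0 hS0.le Ω η₀ htube hINC ε hε0 B hB C O hOC hOo hCcl hD hp ht
      s hs hsη hsS n hn
  /- ── Step 5: the limit offset ── -/
  choose! u huI huC huO using hcross
  obtain ⟨uU, huUI, huU⟩ : ∃ uU ∈ Icc (-s) s, Tendsto u (𝒰 : Filter ℕ) (𝓝 uU) := by
    have hle : ((𝒰.map u : Ultrafilter ℝ) : Filter ℝ) ≤ 𝓟 (Icc (-s) s) := by
      rw [Ultrafilter.coe_map, le_principal_iff]; exact hgood.mono fun n hn ↦ huI n hn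
    obtain ⟨y, hy, hle'⟩ := isCompact_Icc.ultrafilter_le_nhds (𝒰.map u) hle
    exact ⟨y, hy, hle'⟩
  set xU : E4 := x₀ + uU • E4.basisVector 0 with hxU
  have hxlim : Tendsto (fun n ↦ x₀ + u n • E4.basisVector 0) (𝒰 : Filter ℕ) (𝓝 xU) :=
    tendsto_const_nhds.add (huU.smul_const _)
  have hcV : Continuous fun w ↦ Kerr.orbitVel a √(M / r₀ ^ 3) (Kerr.orbitCurve a r₀ √(M / r₀ ^ 3) w) :=
    continuous_iff_continuousAt.2 fun w ↦ (Kerr.hasDerivAt_orbitVel_orbitCurve w).continuousAt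
  /- ── Step 6: `uU ≤ 0` (else the drifted orbit, transplanted, ends at `x_n ∈ O n`) ── -/
  have h6 : uU ≤ 0 := by
    by_contra hpos
    push Not at hpos
    have hκ : 0 < uU / s := div_pos hpos hs
    have hκ1 : uU / s ≤ 1 := (div_le_one hs).2 huUI.2
    -- the reparametrised incidence curve on `[0, 1]`
    have hV := fun w ↦ (hINC M a r₀ (√(M / r₀ ^ 3)) e (uU / s) w hM ha0 haM h3 hcubic rfl he hκ).2.2.2
    set β : ℝ → E4 := fun r ↦ Kerr.orbitCurve a r₀ √(M / r₀ ^ 3) (s * r / e) + (uU / s * (s * r)) • E4.basisVector 0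
      with hβ
    set β' : ℝ → E4 := fun r ↦ s • ((1 / e) • Kerr.orbitVel a √(M / r₀ ^ 3) (Kerr.orbitCurve a r₀ √(M / r₀ ^ 3) (s * r / e)) +
      (uU / s) • E4.basisVector 0) with hβ'
    have hβd : ∀ r, HasDerivAt β (β' r) r := by
      intro r
      have h1 := (hV (s * r)).1
      have h2 : HasDerivAt (fun x : ℝ ↦ s * x) (s * 1) r := (hasDerivAt_id' r).const_mul s
      have h := h1.scomp r h2
      rw [mul_one] at h
      exact h
    have hβ'c : ContinuousOn β' (Icc 0 1) := by
      have : Continuous fun r : ℝ ↦ s * r / e := by fun_prop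
      exact ((((hcV.comp this).const_smul (1 / e)).add continuous_const).const_smul s).continuousOn
    have hβprop : ∀ r ∈ Icc (0:ℝ) 1, HasDerivAt β (β' r) r ∧ Kerr.bilin M a (β r) (β' r) (β' r) < 0 ∧ 0 < β' r 0 := by
      intro r hr
      obtain ⟨-, hbil, hV0, -⟩ := hV (s * r)
      refine ⟨hβd r, ?_, ?_⟩
      · have : Kerr.bilin M a (β r) (β' r) (β' r) = s ^ 2 *
            Kerr.bilin M a (Kerr.orbitCurve a r₀ √(M / r₀ ^ 3) (s * r / e) + (uU / s * (s * r)) • E4.basisVector 0)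
              ((1 / e) • Kerr.orbitVel a √(M / r₀ ^ 3) (Kerr.orbitCurve a r₀ √(M / r₀ ^ 3) (s * r / e)) +
                (uU / s) • E4.basisVector 0)
              ((1 / e) • Kerr.orbitVel a √(M / r₀ ^ 3) (Kerr.orbitCurve a r₀ √(M / r₀ ^ 3) (s * r / e)) +
                (uU / s) • E4.basisVector 0) := by
          simp only [hβ, hβ', map_smul, smul_apply, smul_eq_mul]; ring
        rw [this]
        have hs2 : 0 < s ^ 2 := by positivity
        nlinarith
      · have : β' r 0 = s * (1 + uU / s) := by
          simp only [hβ']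
          rw [show (s • ((1 / e) • Kerr.orbitVel a √(M / r₀ ^ 3) (Kerr.orbitCurve a r₀ √(M / r₀ ^ 3) (s * r / e)) +
            (uU / s) • E4.basisVector 0)) 0 = s * (((1 / e) • Kerr.orbitVel a √(M / r₀ ^ 3)
              (Kerr.orbitCurve a r₀ √(M / r₀ ^ 3) (s * r / e)) + (uU / s) • E4.basisVector 0) 0) from rfl, hV0]
        rw [this]; positivity
    have hthickβ : cthickening (η₀ / 2) (β '' Icc 0 1) ⊆ Ω := by
      refine hthickΓ _ ?_
      rintro z ⟨r, hr, rfl⟩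
      refine ⟨s * r, mul_nonneg hs.le hr.1, ?_, ?_⟩
      · have : s * r ≤ s := by nlinarith [hr.2, hr.1]
        linarith
      · simp only [hβ, add_sub_cancel_left, norm_smul, hne0, mul_one, Real.norm_eq_abs]
        rw [abs_of_nonneg (by have := hr.1; positivity)]
        have : uU / s * (s * r) = uU * r := by field_simp
        rw [this]
        have : uU * r ≤ s * 1 := mul_le_mul huUI.2 hr.2 hr.1 hs.le
        linarith
    have hβ0 : β 0 = Kerr.orbitCurve a r₀ √(M / r₀ ^ 3) 0 := by simp [hβ]
    have hβ1 : β 1 = xU := by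
      simp only [hβ, hxU, mul_one]
      rw [show uU / s * s = uU from div_mul_cancel₀ uU hs.ne', hx₀]
    exact transplant_contra (a := a) hM.le hΩext' hTL hεU hB hD β β' hβ'c hβprop (half_pos hη₀) hthickβ
      (fun _ ↦ Kerr.orbitCurve a r₀ √(M / r₀ ^ 3) 0) (fun n ↦ x₀ + u n • E4.basisVector 0)
      (by rw [hβ0]; exact tendsto_const_nhds) (by rw [hβ1]; exact hxlim)
      (Eventually.of_forall fun n ↦ (hp n).1) (hgood.mono fun n hn ↦ huO n hn)
  /- ── Step 7: `0 ≤ uU` (else `Γ s ∈ I⁺(p₀)`) ── -/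
  have h7 : 0 ≤ uU := by
    by_contra hneg
    push Not at hneg
    have H : ∀ n, ε n < 1 / 200 → ∃ y' ∈ Ω, ‖y' - (x₀ + u n • E4.basisVector 0)‖ < 1 / ((n : ℝ) + 1) ∧
        (y' = Kerr.orbitCurve a r₀ √(M / r₀ ^ 3) 0 ∨ ∃ c : ℝ → E4,
          c (Kerr.orbitCurve a r₀ √(M / r₀ ^ 3) 0 0) = Kerr.orbitCurve a r₀ √(M / r₀ ^ 3) 0 ∧ c (y' 0) = y' ∧
          Kerr.orbitCurve a r₀ √(M / r₀ ^ 3) 0 0 < y' 0 ∧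
          ∀ t ∈ Icc (Kerr.orbitCurve a r₀ √(M / r₀ ^ 3) 0 0) (y' 0), c t ∈ Ω ∧ c t 0 = t ∧
            ∃ v : E4, HasDerivAt c v t ∧ B n (c t) v v ≤ 0 ∧ v 0 = 1) :=
      fun n hn ↦ hreach n _ (huC n hn) _ (by positivity)
    choose! Y' hY'Ω hY'd hY'alt using H
    have h1n : Tendsto (fun n : ℕ ↦ 1 / ((n : ℝ) + 1)) (𝒰 : Filter ℕ) (𝓝 0) :=
      tendsto_one_div_add_atTop_nhds_zero_nat.mono_left h𝒰
    have hY'lim : Tendsto Y' (𝒰 : Filter ℕ) (𝓝 xU) := by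
      rw [tendsto_iff_norm_sub_tendsto_zero]
      have h2 := tendsto_iff_norm_sub_tendsto_zero.1 hxlim
      have h12 : Tendsto (fun n : ℕ ↦ 1 / ((n : ℝ) + 1) + ‖(x₀ + u n • E4.basisVector 0) - xU‖) (𝒰 : Filter ℕ) (𝓝 0) := by
        have := h1n.add h2; rwa [add_zero] at this
      refine squeeze_zero' (Eventually.of_forall fun n ↦ norm_nonneg _) ?_ h12
      filter_upwards [hgood] with n hn
      calc ‖Y' n - xU‖ ≤ ‖Y' n - (x₀ + u n • E4.basisVector 0)‖ + ‖(x₀ + u n • E4.basisVector 0) - xU‖ :=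
            norm_sub_le_norm_sub_add_norm_sub _ _ _
        _ ≤ 1 / ((n : ℝ) + 1) + ‖(x₀ + u n • E4.basisVector 0) - xU‖ := by gcongr; exact (hY'd n hn).le
    rcases Ultrafilter.eventually_or.1 (hgood.mono fun n hn ↦ hY'alt n hn) with hA | hBc
    · -- `Y' n = p₀` along `𝒰`: then `xU = p₀`, impossible (the orbit has moved)
      have hxUp : xU = Kerr.orbitCurve a r₀ √(M / r₀ ^ 3) 0 :=
        tendsto_nhds_unique hY'lim (tendsto_const_nhds.congr' (hA.mono fun n hn ↦ hn.symm))
      have h1 := congrArg (fun z : E4 ↦ z 1) hxUp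
      simp only [hxU, hx₀] at h1
      rw [show (Kerr.orbitCurve a r₀ √(M / r₀ ^ 3) (s / e) + uU • E4.basisVector 0) 1 =
        Kerr.orbitCurve a r₀ √(M / r₀ ^ 3) (s / e) 1 + uU * (E4.basisVector 0 : E4) 1 from rfl] at h1
      have hb1 : (E4.basisVector 0 : E4) 1 = 0 := by simp [E4.basisVector]
      rw [hb1, mul_zero, add_zero] at h1
      exact orbit_apply_one_ne M a r₀ e S hM h3 hS he0 s hs hsS h1
    · -- reaching curves along `𝒰`: `xU ∈ J⁺(p₀)`, and the vertical static curve pushes up to `Γ s ∈ I⁺(p₀)`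
      obtain ⟨U₁, hU₁, hU₁spec⟩ := hBc.exists_mem
      choose! cc hcc0 hccT hT0 hccprop using hU₁spec
      -- eventually `1/(k+1) < s`
      have hsmallk : ∀ᶠ k : ℕ in (𝒰 : Filter ℕ), 1 / ((k : ℝ) + 1) < s := h1n.eventually (gt_mem_nhds hs)
      have hTk : ∀ᶠ k in (𝒰 : Filter ℕ), Y' k 0 ≤ 3 * s := by
        filter_upwards [hgood, hsmallk] with k hk hks
        have h1 : |(Y' k - (x₀ + u k • E4.basisVector 0)) 0| ≤ ‖Y' k - (x₀ + u k • E4.basisVector 0)‖ := by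
          have := PiLp.norm_apply_le (p := 2) (Y' k - (x₀ + u k • E4.basisVector 0)) 0
          rwa [Real.norm_eq_abs] at this
        have h2 : (Y' k - (x₀ + u k • E4.basisVector 0)) 0 = Y' k 0 - (s + u k) := by
          rw [show (Y' k - (x₀ + u k • E4.basisVector 0)) 0 = Y' k 0 - (x₀ 0 + u k * (E4.basisVector 0 : E4) 0)
            from rfl, hx₀0]
          simp [E4.basisVector]
        rw [h2] at h1
        have h3' := (abs_le.1 (h1.trans (hY'd k hk).le)).2
        linarith [(huI k hk).2]
      have hxUext : ∀ z : E4, ‖z - Kerr.orbitCurve a r₀ √(M / r₀ ^ 3) 0‖ ≤ η₀ → z ∈ Kerr.exterior M a := fun z hz ↦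
        hΩext' (hΩnear 0 z le_rfl (by positivity) (by simpa using hz))
      have hx₀p : ‖x₀ - Kerr.orbitCurve a r₀ √(M / r₀ ^ 3) 0‖ ≤ 2 * s := by
        have := horbkin 0 (s / e) (by positivity)
        rw [hx₀]
        have h' : e * (s / e) = s := by field_simp
        rw [h', mul_zero, sub_zero] at this
        exact this
      have hxUp : ‖xU - Kerr.orbitCurve a r₀ √(M / r₀ ^ 3) 0‖ ≤ 3 * s := by
        calc ‖xU - Kerr.orbitCurve a r₀ √(M / r₀ ^ 3) 0‖
            ≤ ‖xU - x₀‖ + ‖x₀ - Kerr.orbitCurve a r₀ √(M / r₀ ^ 3) 0‖ := norm_sub_le_norm_sub_add_norm_sub _ _ _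
          _ ≤ s + 2 * s := by
            gcongr
            rw [hxU, add_sub_cancel_left, norm_smul, hne0, mul_one, Real.norm_eq_abs, abs_le]
            exact ⟨by linarith [huUI.1], huUI.2⟩
          _ = 3 * s := by ring
      have hxUmem : xU ∈ Kerr.exterior M a := hxUext xU (by linarith)
      set pK : Kerr.region a (Kerr.rPlus M a) := ⟨Kerr.orbitCurve a r₀ √(M / r₀ ^ 3) 0, hmem 0⟩ with hpK
      set xUK : Kerr.region a (Kerr.rPlus M a) := ⟨xU, hxUmem⟩ with hxUK
      have hcoord : Continuous fun z : E4 ↦ z 0 := (EuclideanSpace.proj (0 : Fin 4)).continuous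
      have hxUJ : xUK ∈ (Kerr.smoothMetric M a (Kerr.rPlus M a)).causalFuture τK {pK} := by
        refine limit_mem_causalFuture (a := a) hM.le hDL3 (Kerr.orbitCurve a r₀ √(M / r₀ ^ 3) 0) W₂ hcl (min ρ₂ η₀)
          (fun y' hy' ↦ hρW y' (hy'.trans_le (min_le_left _ _)))
          (fun z hz ↦ hxUext z (hz.le.trans (min_le_right _ _))) (l := (𝒰 : Filter ℕ)) ε hε0 hε4 B cc
          (fun _ ↦ 0) (fun k ↦ Y' k 0) ?_ ?_ pK xUK
          (by change ‖Kerr.orbitCurve a r₀ √(M / r₀ ^ 3) 0 - _‖ < _; simp [lt_min hρ₂ hη₀])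
          (lt_min (by linarith) (by linarith) : ‖xU - _‖ < min ρ₂ η₀) ?_ ?_
        · filter_upwards [hU₁] with k hk
          have := hT0 k hk; rw [hp00] at this; exact this.le
        · filter_upwards [hU₁, hgood, hTk] with k hk hkg hkT
          intro s' hs'
          have hs'I : s' ∈ Icc (Kerr.orbitCurve a r₀ √(M / r₀ ^ 3) 0 0) (Y' k 0) := by rwa [hp00]
          obtain ⟨hΩs', h0s', v, hv, hBv, hv0⟩ := hccprop k hk s' hs'I
          -- kinematics from `p₀`
          have hK := (kerr_time_strictMonoOn_and_norm_sub_le M a (fun t ↦ B k (cc k t)) (cc k) 0 s' hM.le hs'.1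
            (fun t' ht' ↦ ?_)).2
          swap
          · have ht'I : t' ∈ Icc (Kerr.orbitCurve a r₀ √(M / r₀ ^ 3) 0 0) (Y' k 0) := by
              rw [hp00]; exact ⟨ht'.1, ht'.2.trans hs'.2⟩
            obtain ⟨hΩt', -, v', hv', hBv', hv0'⟩ := hccprop k hk t' ht'I
            exact ⟨(hB k _ hΩt').trans (by linarith [hε4 k]), v', hv', hBv', by rw [hv0']; exact one_pos⟩
          have hcc0' : cc k 0 = Kerr.orbitCurve a r₀ √(M / r₀ ^ 3) 0 := by
            have := hcc0 k hk; rwa [hp00] at this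
          rw [hcc0', h0s', hp00, sub_zero] at hK
          have hdist : ‖cc k s' - Kerr.orbitCurve a r₀ √(M / r₀ ^ 3) 0‖ ≤ 6 * s := by linarith [hs'.2]
          have hdrift : ‖(50 * ε k * (s' - 0)) • E4.basisVector 0‖ ≤ 2 * s := by
            rw [sub_zero, norm_smul, hne0, mul_one, Real.norm_eq_abs, abs_of_nonneg (by have := hε0 k; have := hs'.1; positivity)]
            have := hε4 k
            have := hε0 k
            nlinarith [hs'.1, hs'.2]
          refine ⟨hH _ (hnear 0 _ le_rfl (by positivity) (by simpa using (hdist.trans (by linarith)))),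
            hB k _ hΩs', ?_, v, hv, hBv, hv0⟩
          calc ‖cc k s' + (50 * ε k * (s' - 0)) • E4.basisVector 0 - Kerr.orbitCurve a r₀ √(M / r₀ ^ 3) 0‖
              ≤ ‖cc k s' - Kerr.orbitCurve a r₀ √(M / r₀ ^ 3) 0‖ + ‖(50 * ε k * (s' - 0)) • E4.basisVector 0‖ := by
                rw [add_sub_right_comm]; exact norm_add_le _ _
            _ ≤ 6 * s + 2 * s := add_le_add hdist hdrift
            _ < min ρ₂ η₀ := lt_min (by linarith) (by linarith)
        · refine tendsto_const_nhds.congr' ?_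
          filter_upwards [hU₁] with k hk
          have := hcc0 k hk; rw [hp00] at this; exact this.symm
        · have h1 : Tendsto (fun k ↦ cc k (Y' k 0)) (𝒰 : Filter ℕ) (𝓝 xU) :=
            hY'lim.congr' (by filter_upwards [hU₁] with k hk; exact (hccT k hk).symm)
          have h2 : Tendsto (fun k ↦ (50 * ε k * (Y' k 0 - 0)) • E4.basisVector 0) (𝒰 : Filter ℕ) (𝓝 0) := by
            have hT : Tendsto (fun k ↦ Y' k 0 - 0) (𝒰 : Filter ℕ) (𝓝 (xU 0 - 0)) :=
              ((hcoord.tendsto xU).comp hY'lim).sub_const 0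
            have := ((hεU.const_mul 50).mul hT).smul_const (E4.basisVector 0)
            simpa using this
          simpa using h1.add h2
      -- the vertical static curve from `xU` up to `Γ s`
      have hvrad : ∀ t : ℝ, Kerr.radius a (xU + t • E4.basisVector 0) = r₀ := fun t ↦ by
        rw [Kerr.radius_add_time_smul_basisVector, hxU, Kerr.radius_add_time_smul_basisVector, hx₀,
          Kerr.radius_orbitCurve hr₀]
      have hvmem : ∀ t : ℝ, xU + t • E4.basisVector 0 ∈ Kerr.exterior M a := fun t ↦ by
        rw [Kerr.mem_exterior, hvrad]; exact max_lt hrp hr₀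
      have hvtl := isFutureTimelikeCurveOn_liftCurve (a := a) hM.le hvmem (s := Icc 0 (-uU))
        (v := fun _ ↦ E4.basisVector 0)
        (fun t _ ↦ by simpa using ((hasDerivAt_id' t).smul_const (E4.basisVector 0)).const_add xU)
        (fun t _ ↦ (kerr_bilin_basisVector_zero_le M a _ hM.le (by rw [hvrad]; exact h3)).trans_lt (by norm_num))
        (fun t _ ↦ by simp [E4.basisVector])
      have hend : (fun t ↦ (⟨xU + t • E4.basisVector 0, hvmem t⟩ : Kerr.exterior M a)) (-uU) =
          (⟨Kerr.orbitCurve a r₀ √(M / r₀ ^ 3) (s / e), hmem (s / e)⟩ : Kerr.region a (Kerr.rPlus M a)) := by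
        apply Subtype.ext
        change xU + (-uU) • E4.basisVector 0 = Kerr.orbitCurve a r₀ √(M / r₀ ^ 3) (s / e)
        rw [hxU, hx₀, neg_smul, add_neg_cancel_right]
      have hI : (⟨Kerr.orbitCurve a r₀ √(M / r₀ ^ 3) (s / e), hmem (s / e)⟩ : Kerr.region a (Kerr.rPlus M a)) ∈
          (Kerr.smoothMetric M a (Kerr.rPlus M a)).chronologicalFuture τK {xUK} :=
        ⟨xUK, rfl, fun t ↦ ⟨xU + t • E4.basisVector 0, hvmem t⟩, 0, -uU, by linarith, hvtl,
          Subtype.ext (by change xU + (0:ℝ) • E4.basisVector 0 = xU; simp), hend⟩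
      exact hLCxs (hmem (s / e)) (hmem 0)
        (LorentzianMetric.mem_chronologicalFuture_of_mem_causalFuture (by exact_mod_cast le_top) hxUJ hI)
  /- ── conclusion ── -/
  have huU0 : uU = 0 := le_antisymm h6 h7
  refine ⟨fun n ↦ x₀ + u n • E4.basisVector 0, ?_, ?_⟩
  · filter_upwards [hgood] with n hn
    exact ⟨huC n hn, huO n hn, u n, huI n hn, rfl⟩
  · have : xU = x₀ := by rw [hxU, huU0, zero_smul, add_zero]
    rw [this] at hxlim
    exact hxlim

end NoC0

/-- **Registered sub-goal `stub_noC0_crossingPoints`** (NoC0KerrChart programme, crux `CaptureSufficesTame`, line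
`only-the-third-law-is-generic`): crossing points converge to the orbit (`NoC0.crossing_points`), verbatim. [cite: ONeillSemiRiemannian1983, Ch. 14, Lemma 14.2] -/
theorem stub_noC0_crossingPoints :
    ∀ (M a : ℝ), ∀ [Kerr.Facts], ∀ [Kerr.SliceFacts], ∀ (hM : 0 < M), (0 ≤ a) → (a ≤ M) → ∀ (r₀ q e S : ℝ), (3 * M ≤ r₀) → (r₀ * (r₀ - 3 * M) ^ 2 = 4 * a ^ 2 * M) → (q = √(M / r₀ ^ 3)) → (e
      = 1 - a * q) → (S = 2 * Real.pi / q) → (0 < e) → (0 < q) → ∀ (p₀ : E4), (p₀ = Kerr.orbitCurve a r₀ q 0) → ∀ (Ω : Set E4), (closure Ω ⊆ (Kerr.exterior M a : Set E4)) → ∀ (η₀ : ℝ), (0 <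
      η₀) → (cthickening η₀ (Kerr.orbitCurve a r₀ q '' Icc (-S) (2 * S)) ⊆ Ω) → (∀ y ∈ cthickening η₀ (Kerr.orbitCurve a r₀ q '' Icc (-S) (2 * S)), Kerr.scalarH M a y ≤ 2 / 5) → ∀ (𝒰 :
      Ultrafilter ℕ), ((𝒰 : Filter ℕ) ≤ atTop) → ∀ (ε : ℕ → ℝ), (∀ n, 0 ≤ ε n) → (∀ n, ε n ≤ 1 / 80) → (Tendsto ε (𝒰 : Filter ℕ) (𝓝 0)) → ∀ (B : ℕ → E4 → E4 →L[ℝ] E4 →L[ℝ] ℝ), (∀ n, ∀ y ∈ Ω,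
      ‖B n y - Kerr.bilin M a y‖ ≤ ε n) → ∀ (C O : ℕ → Set E4), (∀ n, O n ⊆ C n) → (∀ n, IsOpen (O n)) → (∀ n, ∀ y ∈ Ω, y ∈ closure (C n) → y ∈ C n) → (∀ n, ∀ y ∈ C n, ∀ z ∈ Ω, (∃ (c : ℝ →
      E4) (s₁ s₂ : ℝ), s₁ < s₂ ∧ c s₁ = y ∧ c s₂ = z ∧ ∀ t ∈ Icc s₁ s₂, c t ∈ Ω ∧ ∃ v : E4, HasDerivAt c v t ∧ B n (c t) v v < 0 ∧ 0 < v 0) → z ∈ O n) → (∀ n, p₀ ∈ C n ∧ p₀ ∉ O n) → (∀ n, ∀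
      y ∈ C n, p₀ 0 ≤ y 0) → (∀ n, ∀ y ∈ C n, ∀ δ > 0, ∃ y' ∈ Ω, ‖y' - y‖ < δ ∧ (y' = p₀ ∨ ∃ c : ℝ → E4, c (p₀ 0) = p₀ ∧ c (y' 0) = y' ∧ p₀ 0 < y' 0 ∧ ∀ t ∈ Icc (p₀ 0) (y' 0), c t ∈ Ω ∧ c t
      0 = t ∧ ∃ v : E4, HasDerivAt c v t ∧ B n (c t) v v ≤ 0 ∧ v 0 = 1)) → ∀ (W₂ : Set (Kerr.exterior M a)), (∀ (l : Filter ℕ) [l.NeBot] (x z : ℕ → Kerr.exterior M a) (x₀ z₀ : Kerr.exterior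
      M a), x₀ ∈ W₂ → z₀ ∈ W₂ → Tendsto x l (𝓝 x₀) → Tendsto z l (𝓝 z₀) → (∀ᶠ k in l, ∃ (γ : ℝ → Kerr.exterior M a) (a' b' : ℝ), a' ≤ b' ∧ (Kerr.smoothMetric M a (Kerr.rPlus M
      a)).IsFutureCausalCurveOn (Kerr.exteriorSpacetime M a hM.le).timeOrientation γ (Icc a' b') ∧ MapsTo γ (Icc a' b') W₂ ∧ γ a' = x k ∧ γ b' = z k) → z₀ ∈ (Kerr.smoothMetric M a
      (Kerr.rPlus M a)).causalFuture (Kerr.exteriorSpacetime M a hM.le).timeOrientation {x₀}) → ∀ (ρ₂ : ℝ), (0 < ρ₂) → (∀ y : Kerr.exterior M a, ‖(y : E4) - p₀‖ < ρ₂ → y ∈ W₂) → ∀ (s : ℝ),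
      (0 < s) → (10 * s ≤ η₀) → (40 * s ≤ ρ₂) → (2 * s ≤ e * S) → (∀ (h₁ : Kerr.orbitCurve a r₀ q (s / e) ∈ Kerr.exterior M a) (h₂ : p₀ ∈ Kerr.exterior M a), (⟨Kerr.orbitCurve a r₀ q (s /
      e), h₁⟩ : Kerr.region a (Kerr.rPlus M a)) ∉ (Kerr.smoothMetric M a (Kerr.rPlus M a)).chronologicalFuture (Kerr.exteriorSpacetime M a hM.le).timeOrientation {(⟨p₀, h₂⟩ : Kerr.region a
      (Kerr.rPlus M a))}) → ∃ x : ℕ → E4, (∀ᶠ n in (𝒰 : Filter ℕ), x n ∈ C n ∧ x n ∉ O n ∧ ∃ u ∈ Icc (-s) s, x n = Kerr.orbitCurve a r₀ q (s / e) + u • E4.basisVector 0) ∧ Tendsto x (𝒰 :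
      Filter ℕ) (𝓝 (Kerr.orbitCurve a r₀ q (s / e))) :=
  NoC0.crossing_points

end Summit.FinalStateConjecture.FinalStateConjecture.Theorems.PhaseMixingCaptureCaptureSufficesTame

end
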